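import Mathlib
import Summits.ValiantsHypothesis.ValiantsHypothesis.Theorems.LacunarySymmetroidMatrixDescartesMonotoneFlagExact
import Summits.ValiantsHypothesis.ValiantsHypothesis.Theorems.LacunarySymmetroidMatrixDescartesGramDualInertia

/-!
# `MatrixDescartes` (stmt-ValiantsHypothesis-18050) — FLAG FORM OF THE EXACT MONOTONE COUNT, V: SELF-CONTAINED FORM (joint-kernel bases
# exist), EXPONENT RIGIDITY (the count depends only on the letters and their sides), and the RANK FORM of the flag bound

HONEST FRAMING.  Cell `pub-symmetroid`, seat `val-sym-mdr-p2` (gen 22); helper file `--supports` the crux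
`Theses.LacunarySymmetroid.MatrixDescartes` (OPEN), NO closure claim.  Packaging and two corollaries of `…MonotoneFlagExact` /
`…MonotoneFlag`; nothing here bears on the crux in its window, `stub_twoSided`, `DoorA26` / `DoorA34`, registers, or `VP ≠ VNP`.

* `exists_jointKernel_basis` — for any family of real matrices `S l` and predicate `p`, a FULL BASIS MATRIX of the joint kernel
  `⋂_{p l} ker S l` exists: `B : ι × Fin k` with `S l · B = 0` (`p l`), `B·` injective, and range `= ⋂_{p l} ker S l`.
* **`monotone_pencil_flag_exact_exists` (self-contained exact count).**  Monotone sector, `det F ≢ 0`: THERE EXIST full bases `B_U`, `B_L`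
  of `W_U`, `W_L` (of sizes `k_U = dim W_U`, `k_L = dim W_L`) with `Z₊(mult) + k_U + k_L = m + ν(B_LᵀS₀B_L) + π(B_UᵀS₀B_U)`.
* **`monotone_pencil_count_exponent_free` (EXPONENT RIGIDITY).**  Two monotone pencils with the SAME letters, the same pivot and the same
  SIDE for every letter (`d l < d l₀ ↔ d' l < d' l₀` for `l ≠ l₀`), both with `det ≢ 0`, have the SAME number of positive roots counted
  with multiplicity — whatever the exponents.  (On the monotone sector the count is a function of `(S, sides)` alone; compare the tree's
  `forall_posRoots_eq_empty_iff_coherent` (gen 21, `det S₀ ≠ 0`), whose sterility half this extends to singular pivots.)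
* `monotone_pencil_flag_bound_rank` (RANK FORM, no compression data): for any injective `B_U`, `B_L` killed by the upper / lower letters,
  `Z₊(mult) + card α + card β ≤ card ι + min(card β, ν(S₀)) + min(card α, π(S₀))`; in particular `Z₊(mult) + dim W_U + dim W_L ≤ m + rank S₀`-type
  bounds (`ν(BᵀS₀B) ≤ ν(S₀)`, `π(BᵀS₀B) ≤ π(S₀)`: tree `GramDual.negIndex_conj_le` / `posIndex_conj_le`).

[folklore] (linear algebra; Sylvester's law of inertia).  Axioms `propext`, `Classical.choice`, `Quot.sound`.  No definitions.
-/

-- layout Summits/ValiantsHypothesis/ValiantsHypothesis forces the duplicated namespace component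
set_option linter.dupNamespace false

namespace Summit.ValiantsHypothesis.ValiantsHypothesis.Theorems.LacunarySymmetroidMatrixDescartes

open Polynomial Matrix Finset
open scoped BigOperators

namespace GramDual

section Rigidity

variable {ι κ : Type} [Fintype ι] [DecidableEq ι] [Fintype κ] [DecidableEq κ]

omit [DecidableEq ι] [Fintype κ] [DecidableEq κ] in
/-- **Full basis matrix of a joint kernel.**  For real matrices `S l` and a predicate `p` there are `k` and `B : ι × Fin k` with
`S l · B = 0` for `p l`, `B·` injective, and every vector killed by all `S l` (`p l`) in the range of `B·`. [folklore] -/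
theorem exists_jointKernel_basis (S : κ → Matrix ι ι ℝ) (p : κ → Prop) :
    ∃ (k : ℕ) (B : Matrix ι (Fin k) ℝ), (∀ l, p l → S l * B = 0) ∧ Function.Injective B.mulVec ∧
      (∀ v : ι → ℝ, (∀ l, p l → S l *ᵥ v = 0) → ∃ c : Fin k → ℝ, B *ᵥ c = v) := by
  classical
  let W : Submodule ℝ (ι → ℝ) := ⨅ (l : κ) (_ : p l), LinearMap.ker (S l).mulVecLin
  let b : Module.Basis (Fin (Module.finrank ℝ W)) ℝ W := Module.finBasis ℝ W
  have hmemW : ∀ v : ι → ℝ, v ∈ W ↔ ∀ l, p l → S l *ᵥ v = 0 := by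
    intro v
    simp only [W, Submodule.mem_iInf, LinearMap.mem_ker, Matrix.mulVecLin_apply]
  refine ⟨Module.finrank ℝ W, Matrix.of fun i j => (b j : ι → ℝ) i, fun l hl => ?_, ?_, fun v hv => ?_⟩
  · -- columns are kernel vectors
    ext i j
    have hj : S l *ᵥ (b j : ι → ℝ) = 0 := (hmemW _).1 (b j).2 l hl
    have h := congrFun hj i
    simp only [Matrix.mulVec, dotProduct, Pi.zero_apply] at h
    simp only [Matrix.mul_apply, Matrix.of_apply, Matrix.zero_apply]
    exact h
  · -- injectivity: `B c = Σ c_j b_j` and the `b_j` are independent in `ι → ℝ`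
    have hcomb : ∀ c : Fin (Module.finrank ℝ W) → ℝ,
        (Matrix.of fun i j => (b j : ι → ℝ) i) *ᵥ c = ∑ j, c j • (b j : ι → ℝ) := by
      intro c; funext i
      simp only [Matrix.mulVec, dotProduct, Matrix.of_apply, Finset.sum_apply, Pi.smul_apply, smul_eq_mul]
      exact Finset.sum_congr rfl fun j _ => mul_comm _ _
    have hli : LinearIndependent ℝ (fun j => (b j : ι → ℝ)) := b.linearIndependent.map' W.subtype (Submodule.ker_subtype W)
    intro c c' h
    have h0 : (Matrix.of fun i j => (b j : ι → ℝ) i) *ᵥ (c - c') = 0 := by rw [Matrix.mulVec_sub, h, sub_self]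
    rw [hcomb] at h0
    have := Fintype.linearIndependent_iff.1 hli (c - c') h0
    funext j
    have hj := this j
    rw [Pi.sub_apply, sub_eq_zero] at hj
    exact hj
  · -- spanning: coordinates in the basis
    have hvW : v ∈ W := (hmemW v).2 hv
    refine ⟨fun j => b.repr ⟨v, hvW⟩ j, ?_⟩
    have hsum := b.sum_repr ⟨v, hvW⟩
    have hcoe := congrArg (fun w : W => (w : ι → ℝ)) hsum
    simp only [Submodule.coe_sum, Submodule.coe_smul] at hcoe
    funext i
    have hi := congrFun hcoe i
    simp only [Finset.sum_apply, Pi.smul_apply, smul_eq_mul] at hi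
    simp only [Matrix.mulVec, dotProduct, Matrix.of_apply]
    rw [← hi]
    exact Finset.sum_congr rfl fun j _ => mul_comm _ _

/-- **SELF-CONTAINED EXACT COUNT.**  Monotone sector, `det F ≢ 0`: there exist full bases `B_U : ι × Fin k_U`, `B_L : ι × Fin k_L` of the joint
kernels of the upper / lower letters, and with `C_U = B_UᵀS₀B_U`, `C_L = B_LᵀS₀B_L`:
`Z₊(mult) + k_U + k_L = card ι + ν(C_L) + π(C_U)`. [folklore] -/
theorem monotone_pencil_flag_exact_exists (d : κ → ℕ) (S : κ → Matrix ι ι ℝ) (hS : ∀ l, (S l).IsSymm) (l₀ : κ)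
    (hmono : ∀ l, l ≠ l₀ → ((S l).PosSemidef ∧ d l₀ < d l) ∨ ((-(S l)).PosSemidef ∧ d l < d l₀))
    (hdet : Matrix.det (∑ l, ((Polynomial.X : Polynomial ℝ) ^ d l) • (S l).map Polynomial.C) ≠ 0) :
    ∃ (kU kL : ℕ) (BU : Matrix ι (Fin kU) ℝ) (BL : Matrix ι (Fin kL) ℝ)
      (hCU : (BUᵀ * S l₀ * BU).IsHermitian) (hCL : (BLᵀ * S l₀ * BL).IsHermitian),
      (∀ l, d l₀ < d l → S l * BU = 0) ∧ Function.Injective BU.mulVec ∧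
      (∀ v : ι → ℝ, (∀ l, d l₀ < d l → S l *ᵥ v = 0) → ∃ c, BU *ᵥ c = v) ∧
      (∀ l, d l < d l₀ → S l * BL = 0) ∧ Function.Injective BL.mulVec ∧
      (∀ v : ι → ℝ, (∀ l, d l < d l₀ → S l *ᵥ v = 0) → ∃ c, BL *ᵥ c = v) ∧
      Multiset.card ((Matrix.det (∑ l, ((Polynomial.X : Polynomial ℝ) ^ d l) • (S l).map Polynomial.C)).roots.filter
          (fun t => 0 < t)) + kU + kL
        = Fintype.card ι + Fintype.card {j // hCL.eigenvalues j < 0} + Fintype.card {j // 0 < hCU.eigenvalues j} := by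
  obtain ⟨kU, BU, hBU, hBUi, hBUspan⟩ := exists_jointKernel_basis S (fun l => d l₀ < d l)
  obtain ⟨kL, BL, hBL, hBLi, hBLspan⟩ := exists_jointKernel_basis S (fun l => d l < d l₀)
  have hCU : (BUᵀ * S l₀ * BU).IsHermitian := isHermitian_compression (hS l₀) BU
  have hCL : (BLᵀ * S l₀ * BL).IsHermitian := isHermitian_compression (hS l₀) BL
  have h := monotone_pencil_flag_exact d S hS l₀ hmono hdet BU hBU hBUi hBUspan BL hBL hBLi hBLspan hCU hCL
  refine ⟨kU, kL, BU, BL, hCU, hCL, hBU, hBUi, hBUspan, hBL, hBLi, hBLspan, ?_⟩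
  rw [Fintype.card_fin, Fintype.card_fin] at h
  exact h

/-- **EXPONENT RIGIDITY ON THE MONOTONE SECTOR.**  Same letters, same pivot, same side for every letter, both determinants `≢ 0` ⇒ the
same number of positive roots counted with multiplicity, whatever the two exponent vectors. [folklore] -/
theorem monotone_pencil_count_exponent_free (d d' : κ → ℕ) (S : κ → Matrix ι ι ℝ) (hS : ∀ l, (S l).IsSymm) (l₀ : κ)
    (hmono : ∀ l, l ≠ l₀ → ((S l).PosSemidef ∧ d l₀ < d l) ∨ ((-(S l)).PosSemidef ∧ d l < d l₀))
    (hsides : ∀ l, l ≠ l₀ → (d l < d l₀ ↔ d' l < d' l₀) ∧ (d l₀ < d l ↔ d' l₀ < d' l))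
    (hdet : Matrix.det (∑ l, ((Polynomial.X : Polynomial ℝ) ^ d l) • (S l).map Polynomial.C) ≠ 0)
    (hdet' : Matrix.det (∑ l, ((Polynomial.X : Polynomial ℝ) ^ d' l) • (S l).map Polynomial.C) ≠ 0) :
    Multiset.card ((Matrix.det (∑ l, ((Polynomial.X : Polynomial ℝ) ^ d l) • (S l).map Polynomial.C)).roots.filter
        (fun t => 0 < t))
      = Multiset.card ((Matrix.det (∑ l, ((Polynomial.X : Polynomial ℝ) ^ d' l) • (S l).map Polynomial.C)).roots.filter
        (fun t => 0 < t)) := by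
  have hmono' : ∀ l, l ≠ l₀ → ((S l).PosSemidef ∧ d' l₀ < d' l) ∨ ((-(S l)).PosSemidef ∧ d' l < d' l₀) := by
    intro l hl
    rcases hmono l hl with ⟨h, hdl⟩ | ⟨h, hdl⟩
    · exact Or.inl ⟨h, ((hsides l hl).2).1 hdl⟩
    · exact Or.inr ⟨h, ((hsides l hl).1).1 hdl⟩
  obtain ⟨kU, BU, hBU, hBUi, hBUspan⟩ := exists_jointKernel_basis S (fun l => d l₀ < d l)
  obtain ⟨kL, BL, hBL, hBLi, hBLspan⟩ := exists_jointKernel_basis S (fun l => d l < d l₀)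
  have hCU : (BUᵀ * S l₀ * BU).IsHermitian := isHermitian_compression (hS l₀) BU
  have hCL : (BLᵀ * S l₀ * BL).IsHermitian := isHermitian_compression (hS l₀) BL
  have h := monotone_pencil_flag_exact d S hS l₀ hmono hdet BU hBU hBUi hBUspan BL hBL hBLi hBLspan hCU hCL
  -- the same bases serve `d'` (the sides agree)
  have hBU' : ∀ l, d' l₀ < d' l → S l * BU = 0 := by
    intro l hl
    have hl0 : l ≠ l₀ := fun h => by rw [h] at hl; exact lt_irrefl _ hl
    exact hBU l (((hsides l hl0).2).2 hl)
  have hBL' : ∀ l, d' l < d' l₀ → S l * BL = 0 := by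
    intro l hl
    have hl0 : l ≠ l₀ := fun h => by rw [h] at hl; exact lt_irrefl _ hl
    exact hBL l (((hsides l hl0).1).2 hl)
  have hBUspan' : ∀ v : ι → ℝ, (∀ l, d' l₀ < d' l → S l *ᵥ v = 0) → ∃ c : Fin kU → ℝ, BU *ᵥ c = v := by
    intro v hv
    refine hBUspan v fun l hl => ?_
    have hl0 : l ≠ l₀ := fun h => by rw [h] at hl; exact lt_irrefl _ hl
    exact hv l (((hsides l hl0).2).1 hl)
  have hBLspan' : ∀ v : ι → ℝ, (∀ l, d' l < d' l₀ → S l *ᵥ v = 0) → ∃ c : Fin kL → ℝ, BL *ᵥ c = v := by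
    intro v hv
    refine hBLspan v fun l hl => ?_
    have hl0 : l ≠ l₀ := fun h => by rw [h] at hl; exact lt_irrefl _ hl
    exact hv l (((hsides l hl0).1).1 hl)
  have h' := monotone_pencil_flag_exact d' S hS l₀ hmono' hdet' BU hBU' hBUi hBUspan' BL hBL' hBLi hBLspan' hCU hCL
  omega

/-- **RANK FORM OF THE FLAG BOUND** (no compression data needed): monotone sector, `det F ≢ 0`, any injective `B_U`, `B_L` killed by the
upper / lower letters ⇒ `Z₊(mult) + card α + card β ≤ card ι + min(card β, ν(S₀)) + min(card α, π(S₀))`. [folklore] -/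
theorem monotone_pencil_flag_bound_rank (d : κ → ℕ) (S : κ → Matrix ι ι ℝ) (hS : ∀ l, (S l).IsSymm) (l₀ : κ)
    (hmono : ∀ l, l ≠ l₀ → ((S l).PosSemidef ∧ d l₀ < d l) ∨ ((-(S l)).PosSemidef ∧ d l < d l₀))
    (hdet : Matrix.det (∑ l, ((Polynomial.X : Polynomial ℝ) ^ d l) • (S l).map Polynomial.C) ≠ 0)
    {α β : Type} [Fintype α] [DecidableEq α] [Fintype β] [DecidableEq β]
    (BU : Matrix ι α ℝ) (hBU : ∀ l, d l₀ < d l → S l * BU = 0) (hBUi : Function.Injective BU.mulVec)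
    (BL : Matrix ι β ℝ) (hBL : ∀ l, d l < d l₀ → S l * BL = 0) (hBLi : Function.Injective BL.mulVec)
    (h₀ : (S l₀).IsHermitian) :
    Multiset.card ((Matrix.det (∑ l, ((Polynomial.X : Polynomial ℝ) ^ d l) • (S l).map Polynomial.C)).roots.filter
        (fun t => 0 < t)) + Fintype.card α + Fintype.card β
      ≤ Fintype.card ι + min (Fintype.card β) (Fintype.card {j // h₀.eigenvalues j < 0})
        + min (Fintype.card α) (Fintype.card {j // 0 < h₀.eigenvalues j}) := by
  classical
  have hCU : (BUᵀ * S l₀ * BU).IsHermitian := isHermitian_compression (hS l₀) BU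
  have hCL : (BLᵀ * S l₀ * BL).IsHermitian := isHermitian_compression (hS l₀) BL
  have h := monotone_pencil_flag_bound d S hS l₀ hmono hdet BU hBU hBUi BL hBL hBLi hCU hCL
  have hν : Fintype.card {j // hCL.eigenvalues j < 0} ≤ Fintype.card {j // h₀.eigenvalues j < 0} := negIndex_conj_le h₀ BL hCL
  have hπ : Fintype.card {j // 0 < hCU.eigenvalues j} ≤ Fintype.card {j // 0 < h₀.eigenvalues j} := posIndex_conj_le h₀ BU hCU
  have hν' : Fintype.card {j // hCL.eigenvalues j < 0} ≤ Fintype.card β := Fintype.card_subtype_le _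
  have hπ' : Fintype.card {j // 0 < hCU.eigenvalues j} ≤ Fintype.card α := Fintype.card_subtype_le _
  have h1 := le_min hν' hν
  have h2 := le_min hπ' hπ
  omega

end Rigidity

end GramDual

end Summit.ValiantsHypothesis.ValiantsHypothesis.Theorems.LacunarySymmetroidMatrixDescartes
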